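import Summits.QuantumFields.YangMills.Theorems.MirrorModularBoostsHypercubicLimitClosureHalvesDefs
import Summits.QuantumFields.YangMills.Theorems.MirrorModularBoostsHypercubicLimitCouplingResponseDefsC
import Summits.QuantumFields.YangMills.Theorems.MirrorModularBoostsHypercubicLimitPlaneLimitsDefs
import Summits.QuantumFields.YangMills.Theorems.GapAtCorrelationLength.Negative.GapAtCorrelationLengthFalseOfLightFluxGroup
import HarnessLib

/-!
# Crux `HypercubicLimit` (stmt-QuantumFields-16154 / 16120 / 8646): the ∃-form heart H16 is false modulo a light-flux group

Helper file for the crux item stmt-QuantumFields-16154 (`CoincidenceRotationBootstrap.HypercubicLimit`), line `peel-and-disseminate`,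
reshape 6 (c5 seat) — the reason reshape 6 RETIRED reshape 5's sole registered stub.  H16 (`stub_rpCoreDisjoint` of
`Cruxes/HypercubicLimit/Lines/peel_and_disseminate.lean` reshape 5, character-identical to the registered heart of the twin crux
stmt-QuantumFields-16120 `Cruxes/WeakCouplingHypercubicLimit/Lines/Sketch.lean` and to the 8646 registry) asks, for EVERY compact simple
`G`, a weak-coupling scheme with `RPSpectral r sch Δ C`: RP-spectral relative clustering of reflected slab functionals over the spatially
GLOBAL slab class.  That is exactly the conjunct by which W₁ `ScalingWindowSplit.GapAtCorrelationLength` (stmt-18927) was judged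
refuted-misstated modulo `LightFluxGroup` (landed `GapAtCorrelationLength_false_of_LightFluxGroup`: for a centre-free admissible group such
as `SO(3)` the disc-repaired ℤ₂ magnetic flux through a spatial 2-torus is a bounded one-slice functional, nearly conserved in Euclidean
time, populated in both sectors — 't Hooft's light flux), and the same bookkeeping refutes H16 at such a `G`:
`rpCoreDisjointAt_false_of_lightFluxMode` (one group, weakest hypotheses: weak coupling and the RP-spectral clause only) and
`not_rpCoreDisjoint_of_lightFluxGroup` (`LightFluxGroup → ¬ H16`, H16 written verbatim as registered).  `LightFluxGroup` is physics-certain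
and rigorously open; H16 is therefore not refuted in the tree, but it is no longer an honest registered debt: the repaired triple
(`Theorems/CoincidenceRotationBootstrapHypercubicLimitOfLocalTriple.lean`, local slab class) replaces it.  No definitions, no sorry.
Refs: tHooft1979Flux; BorgsSeiler1983 §II; DeforcrandJahn2003 §4.
-/

set_option autoImplicit false

noncomputable section

open scoped SchwartzMap ENNReal BigOperators Topology
open MeasureTheory Filter Topology Set Function
open Literature.MathematicalPhysics.AQFT Literature.MathematicalPhysics.QuantumLattice
open Literature.MathematicalPhysics.QuantumFieldTheory
open Summit.QuantumFields.YangMills.Cruxes.HypercubicLimit.CouplingResponse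
  (PolyVolume PolyRenorm UniformFunctionalBoundPlanes RPSpectral)
open Summit.QuantumFields.YangMills.Theorems.GapAtCorrelationLength.Negative (LightFluxMode LightFluxGroup)

namespace Summit.QuantumFields.YangMills.Theorems.HypercubicLimit.RpCoreLightFlux

/-- **A light-flux mode at an admissible `G` refutes H16 at `G`.**  Bookkeeping identical to the landed
`gapAtCorrelationLength_false_of_lightFluxMode` (H16's clause `RPSpectral r sch Δ C` is the GLOBAL slab-class clustering, the very
conjunct of W₁ that the light flux violates): at a step `k` where the clause is active and `β_k` is in the light-flux regime take
`ε := Δ a_k / 8` and the witness `(S, T, n, Y)`; the clause bounds the covariance by `e^{−εS}(e^{−Δ a_k S/8} + |C| e^{−7Δ a_k S/8}) < e^{−εS}`.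
-- adapted from Theorems/GapAtCorrelationLength/Negative/GapAtCorrelationLengthFalseOfLightFluxGroup.lean [folklore] -/
theorem rpCoreDisjointAt_false_of_lightFluxMode
    (G : Type) [Group G] [TopologicalSpace G] [IsTopologicalGroup G] [CompactSpace G]
    (hH : LightFluxMode G)
    (hcoreG : letI : MeasurableSpace G := borel G
      haveI : BorelSpace G := ⟨rfl⟩
      ∃ (r : LatticeRep G) (sch : SpeciesScheme (YMSpecies G)),
        sch.HasWeakCouplingLimit ∧ (∃ Δ C : ℝ, 0 < Δ ∧ RPSpectral r sch Δ C)) : False := by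
  letI : MeasurableSpace G := borel G
  haveI : BorelSpace G := ⟨rfl⟩
  obtain ⟨r, sch, hweak, Δ, C, hΔ, hRP⟩ := hcoreG
  unfold RPSpectral at hRP
  -- a step `k` at which the RP-spectral clause is active and the coupling is in the light-flux regime
  obtain ⟨k, hRPk, hβk⟩ := (hRP.and (hweak.eventually (hH r))).exists
  have ha : 0 < sch.a k := sch.a_pos k
  have hΔa : 0 < Δ * sch.a k := mul_pos hΔ ha
  set ε : ℝ := Δ * sch.a k / 8 with hε_def
  have hε : 0 < ε := by positivity
  set h : ℝ → ℝ := fun x =>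
      Real.exp (-(Δ * sch.a k * x / 8)) + |C| * Real.exp (-(7 * (Δ * sch.a k) * x / 8)) with hh_def
  have hh : Tendsto h atTop (𝓝 0) := by
    have h1 : Tendsto (fun x : ℝ => Δ * sch.a k * x / 8) atTop atTop :=
      (tendsto_id.const_mul_atTop hΔa).atTop_div_const (by norm_num)
    have h7 : Tendsto (fun x : ℝ => 7 * (Δ * sch.a k) * x / 8) atTop atTop :=
      (tendsto_id.const_mul_atTop (by positivity : (0:ℝ) < 7 * (Δ * sch.a k))).atTop_div_const
        (by norm_num)
    have e1 : Tendsto (fun x : ℝ => Real.exp (-(Δ * sch.a k * x / 8))) atTop (𝓝 0) :=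
      Real.tendsto_exp_atBot.comp (tendsto_neg_atTop_atBot.comp h1)
    have e2 : Tendsto (fun x : ℝ => |C| * Real.exp (-(7 * (Δ * sch.a k) * x / 8))) atTop
        (𝓝 (|C| * 0)) :=
      (Real.tendsto_exp_atBot.comp (tendsto_neg_atTop_atBot.comp h7)).const_mul |C|
    simpa [hh_def] using e1.add e2
  have hhN : Tendsto (fun S : ℕ => h S) atTop (𝓝 0) := hh.comp tendsto_natCast_atTop_atTop
  obtain ⟨N₀, hN₀⟩ := eventually_atTop.1 (hhN.eventually (gt_mem_nhds (by norm_num : (0:ℝ) < 1)))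
  obtain ⟨S, T, n, hMS, h2, h4, Y, hYm, hYb, hYdep, hcov⟩ := hβk ε hε (max N₀ (sch.L k))
  have hLS : sch.L k ≤ S := (le_max_right _ _).trans hMS
  have hNS : N₀ ≤ S := (le_max_left _ _).trans hMS
  have key := hRPk S T n hLS h2 Y 1 hYm hYb hYdep
  haveI : IsProbabilityMeasure (wilsonMeasure (d := 4) (L := 2 * S + 1) (G := G) r.ρ (sch.β k)) :=
    isProbabilityMeasure_wilsonMeasure r.ρ r.continuous _
  have hI0 : (∫ U, Y (torusLift (2 * S + 1) (GaugeConfig.timeReflect U)) * Y (torusLift (2 * S + 1) U)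
      ∂(wilsonMeasure r.ρ (sch.β k) : Measure (GaugeConfig 4 (2 * S + 1) G))) ≤ 1 := by
    have hb : ∀ U : GaugeConfig 4 (2 * S + 1) G,
        ‖Y (torusLift (2 * S + 1) (GaugeConfig.timeReflect U)) * Y (torusLift (2 * S + 1) U)‖ ≤ 1 := by
      intro U
      rw [Real.norm_eq_abs, abs_mul]
      have h1 := hYb (torusLift (2 * S + 1) (GaugeConfig.timeReflect U))
      have h2 := hYb (torusLift (2 * S + 1) U)
      have h3 := abs_nonneg (Y (torusLift (2 * S + 1) (GaugeConfig.timeReflect U)))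
      nlinarith
    have hint := norm_integral_le_of_norm_le_const
      (μ := (wilsonMeasure r.ρ (sch.β k) : Measure (GaugeConfig 4 (2 * S + 1) G)))
      (Eventually.of_forall hb)
    simp only [probReal_univ, mul_one, Real.norm_eq_abs] at hint
    exact (le_abs_self _).trans hint
  generalize hIn_def : (∫ U, Y (torusLift (2 * S + 1) (GaugeConfig.timeReflect U)) *
      Y (configShift (-Pi.single 0 (n : ℤ)) (torusLift (2 * S + 1) U))
      ∂(wilsonMeasure r.ρ (sch.β k) : Measure (GaugeConfig 4 (2 * S + 1) G))) = In at key hcov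
  generalize hI0_def : (∫ U, Y (torusLift (2 * S + 1) (GaugeConfig.timeReflect U)) *
      Y (torusLift (2 * S + 1) U)
      ∂(wilsonMeasure r.ρ (sch.β k) : Measure (GaugeConfig 4 (2 * S + 1) G))) = I0 at key hI0
  generalize hm_def : (∫ U, Y (torusLift (2 * S + 1) U)
      ∂(wilsonMeasure r.ρ (sch.β k) : Measure (GaugeConfig 4 (2 * S + 1) G))) = m at key hcov
  have hS4 : (S : ℝ) ≤ 4 * n := by exact_mod_cast h4
  have hexp_n : Real.exp (-(Δ * sch.a k * n)) ≤ Real.exp (-(Δ * sch.a k * S / 4)) := by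
    apply Real.exp_le_exp.2
    nlinarith [mul_le_mul_of_nonneg_left hS4 hΔa.le]
  have hsplit4 : Real.exp (-(Δ * sch.a k * S / 4)) =
      Real.exp (-(ε * S)) * Real.exp (-(Δ * sch.a k * S / 8)) := by
    rw [← Real.exp_add, hε_def]; ring_nf
  have hsplit1 : Real.exp (-(Δ * sch.a k * S)) =
      Real.exp (-(ε * S)) * Real.exp (-(7 * (Δ * sch.a k) * S / 8)) := by
    rw [← Real.exp_add, hε_def]; ring_nf
  have hE : 0 < Real.exp (-(ε * S)) := Real.exp_pos _
  have hexp0 : 0 ≤ Real.exp (-(Δ * sch.a k * n)) := Real.exp_nonneg _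
  have hdiff : I0 - m ^ 2 ≤ 1 := by nlinarith [sq_nonneg m]
  have hup : In - m ^ 2 ≤ Real.exp (-(ε * S)) * h S := by
    have t1 : Real.exp (-(Δ * sch.a k * n)) * (I0 - m ^ 2) ≤
        Real.exp (-(ε * S)) * Real.exp (-(Δ * sch.a k * S / 8)) := by
      calc Real.exp (-(Δ * sch.a k * n)) * (I0 - m ^ 2)
          ≤ Real.exp (-(Δ * sch.a k * n)) * 1 := mul_le_mul_of_nonneg_left hdiff hexp0
        _ ≤ Real.exp (-(Δ * sch.a k * S / 4)) := by simpa using hexp_n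
        _ = _ := hsplit4
    have t2 : C * (1 : ℝ) ^ 2 * Real.exp (-(Δ * sch.a k * S)) ≤
        Real.exp (-(ε * S)) * (|C| * Real.exp (-(7 * (Δ * sch.a k) * S / 8))) := by
      rw [hsplit1]
      have hC := le_abs_self C
      have hE7 : 0 ≤ Real.exp (-(7 * (Δ * sch.a k) * S / 8)) := Real.exp_nonneg _
      nlinarith [mul_nonneg hE.le hE7]
    have hlhs : In - m ^ 2 ≤ |In - m ^ 2| := le_abs_self _
    have : In - m ^ 2 ≤ Real.exp (-(ε * S)) * Real.exp (-(Δ * sch.a k * S / 8)) +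
        Real.exp (-(ε * S)) * (|C| * Real.exp (-(7 * (Δ * sch.a k) * S / 8))) := by linarith
    simpa [hh_def, mul_add] using this
  have hhS : h S < 1 := hN₀ S hNS
  have : Real.exp (-(ε * S)) * h S < Real.exp (-(ε * S)) * 1 := mul_lt_mul_of_pos_left hhS hE
  linarith

/-- **H16 is false modulo a light-flux group** (`LightFluxGroup → ¬ H16`; intended inhabitant `G = SO(3)`, `lightFluxGroup_of_SO3`).
This is why reshape 6 retires reshape 5's sole stub: H16 quantifies its RP-spectral clause over the GLOBAL slab class for EVERY
compact simple `G`, `SO(3)` included.  (Physics-certain, rigorously open hypothesis; H16 is not refuted in the tree.) [folklore] -/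
theorem not_rpCoreDisjoint_of_lightFluxGroup (hH : LightFluxGroup) :
    ¬ (∀ (G : Type) [Group G] [TopologicalSpace G] [IsTopologicalGroup G] [CompactSpace G]
      [MeasurableSpace G] [BorelSpace G], IsCompactSimpleLieGroup G →
      ∃ (r : LatticeRep G) (sch : SpeciesScheme (YMSpecies G)),
        sch.HasWeakCouplingLimit ∧ PolyVolume sch ∧ PolyRenorm r sch ∧ UniformFunctionalBoundPlanes r sch ∧
        (∃ Δ C : ℝ, 0 < Δ ∧ RPSpectral r sch Δ C) ∧
        (∃ (f g h : 𝓢(EuclideanSpace ℝ (Fin 4), ℝ)) (δ : ℝ),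
          Disjoint (tsupport f) (tsupport g) ∧ Disjoint (tsupport f) (tsupport h) ∧
          Disjoint (tsupport g) (tsupport h) ∧ 0 < δ ∧
          ∀ᶠ k in atTop, δ ≤
            |latticeSchwinger r.ρ sch (fun s => s.F) k 3 (fun _ => r.curvature) ![f, g, h] -
              latticeSchwinger r.ρ sch (fun s => s.F) k 1 (fun _ => r.curvature) ![f] *
                latticeSchwinger r.ρ sch (fun s => s.F) k 2 (fun _ => r.curvature) ![g, h] -
              latticeSchwinger r.ρ sch (fun s => s.F) k 1 (fun _ => r.curvature) ![g] *
                latticeSchwinger r.ρ sch (fun s => s.F) k 2 (fun _ => r.curvature) ![f, h] -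
              latticeSchwinger r.ρ sch (fun s => s.F) k 1 (fun _ => r.curvature) ![h] *
                latticeSchwinger r.ρ sch (fun s => s.F) k 2 (fun _ => r.curvature) ![f, g] +
              2 * (latticeSchwinger r.ρ sch (fun s => s.F) k 1 (fun _ => r.curvature) ![f] *
                latticeSchwinger r.ρ sch (fun s => s.F) k 1 (fun _ => r.curvature) ![g] *
                latticeSchwinger r.ρ sch (fun s => s.F) k 1 (fun _ => r.curvature) ![h])|)) := by
  obtain ⟨G, _, _, _, _, hG, hHG⟩ := hH
  intro hcore
  letI : MeasurableSpace G := borel G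
  haveI : BorelSpace G := ⟨rfl⟩
  obtain ⟨r, sch, hw, -, -, -, hRP, -⟩ := hcore G hG
  exact rpCoreDisjointAt_false_of_lightFluxMode G hHG ⟨r, sch, hw, hRP⟩


end Summit.QuantumFields.YangMills.Theorems.HypercubicLimit.RpCoreLightFlux

end
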